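import Summits.AtomisticToContinuum.FouriersLaw.Theorems.BondHeatUncertaintyBoundedResponseTransientContactSpectrumA

/-!
# `SurplusSpectrum` (`TransientContactSpectrum`) — the junction-side reading of the transient floor (lens-1 g92 node A) — part 2 of 3 (sequel of `…BondHeatUncertaintyBoundedResponseTransientContactSpectrumA`)

Split for the 400-line cap by the landing lane (hand-2 g35); the module docstring of part 1 (`…BondHeatUncertaintyBoundedResponseTransientContactSpectrumA`) describes the whole node.  Same namespace; all FQNs unchanged.
0 sorry; standard axioms.
-/

noncomputable section

namespace Summit.AtomisticToContinuum.FouriersLaw.Theorems.BoundedResponse.TransientContact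

open MeasureTheory ProbabilityTheory Filter Set Topology
open Literature.MathematicalPhysics.KineticTheory.HeatConduction
open Summit.AtomisticToContinuum.FouriersLaw.Theses.BondHeatUncertainty
open Summit.AtomisticToContinuum.FouriersLaw.Theorems.SubdiffusiveBondHeat
open Summit.AtomisticToContinuum.FouriersLaw.Theorems.BoundedResponse.TransientBand
  (integral_min_mul_eq_sub integral_min_mul_ge_of_floor integrableOn_cos_mul_kernel abs_cosTransform_le dip_eq_sub_cosTransform
    measurable_cosTransform cosTransform_nonneg_of_lagIntegral_nonneg integral_fejer_mul_cosTransform fejerWeight_le integral_Ioc_fejerWeight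
    one_le_two_sub_sin_div integrable_fejerAverage highBand_spectral_ge)

/-! ### Frequency-band grading of the equilibrium floor: `ESF ⟸ (R) ∧ (HB) ∧ (WF)` -/

/-- **The band split.**  Fixed-`N` regularity (R), the free microscopic band (HB) and the infrared
`√ω`-floor (WF) give the equilibrium surplus floor: for `N` beyond the thresholds and `cN² ≥ 1`,
`s_N(cN²) ≥ −T²((max A 0)c₂ + max B 0)/c₁ · √c · N`; the finitely many smaller `N ≥ 2` are absorbed
into the constant. [folklore] -/
theorem equilibriumSurplusFloor_of_spectralFloors (hR : ContactKernelRegular)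
    (hH : HighBandSurplusFloor) (hF : ContactWarburgFloor) : EquilibriumSurplusFloor := by
  intro ω₂ lam β γ hω hl hβ hγ T hT c hc
  obtain ⟨A, N₀, hA⟩ := hF ω₂ lam β γ hω hl hβ hγ T hT
  obtain ⟨B, N₀', hB⟩ := hH ω₂ lam β γ hω hl hβ hγ T hT
  obtain ⟨N₁, hN₁⟩ := exists_nat_ge (1 / Real.sqrt c)
  set P := pinnedChain ω₂ lam β γ with hP
  set c₁ : ℝ := ∫ ω in Ioi (0 : ℝ), (1 - Real.cos ω) / ω ^ 2 with hc₁
  set c₂ : ℝ := ∫ v in Ioi (0 : ℝ), (1 - Real.cos v) / (v * Real.sqrt v) with hc₂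
  have hc₁0 : 0 < c₁ := integral_one_sub_cos_div_sq_pos
  have hc₂0 : 0 ≤ c₂ := integral_one_sub_cos_div_mul_sqrt_nonneg
  set M : ℕ := max (max N₀ N₀') N₁ with hM
  set Cmain : ℝ := T ^ 2 * (((max A 0) * c₂ + max B 0) / c₁ * Real.sqrt c) with hCmain
  set C₀ : ℝ := ∑ n ∈ Finset.range M, |contactSurplus P T n (c * (n : ℝ) ^ 2)| with hC₀
  have hCmain0 : 0 ≤ Cmain := by positivity
  have hC₀0 : 0 ≤ C₀ := Finset.sum_nonneg fun n _ => abs_nonneg _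
  refine ⟨Cmain + C₀, fun N hN => ?_⟩
  have hN1 : (1 : ℝ) ≤ N := by
    have : (2 : ℝ) ≤ N := by exact_mod_cast hN
    linarith
  rcases lt_or_ge N M with hlt | hge
  · -- finitely many small `N`: absorbed by `C₀`
    have h1 : |contactSurplus P T N (c * (N : ℝ) ^ 2)| ≤ C₀ :=
      Finset.single_le_sum (f := fun n => |contactSurplus P T n (c * (n : ℝ) ^ 2)|)
        (fun i _ => abs_nonneg _) (Finset.mem_range.mpr hlt)
    have h2 := neg_abs_le (contactSurplus P T N (c * (N : ℝ) ^ 2))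
    nlinarith
  · -- large `N`: the spectral floor
    have hN₀ : N₀ ≤ N := le_trans (le_trans (le_max_left _ _) (le_max_left _ _)) hge
    have hN₀' : N₀' ≤ N := le_trans (le_trans (le_max_right _ _) (le_max_left _ _)) hge
    have hNN₁ : N₁ ≤ N := le_trans (le_max_right _ _) hge
    have hsc : 0 < Real.sqrt c := Real.sqrt_pos.2 hc
    have hN₁' : 1 / Real.sqrt c ≤ N := hN₁.trans (by exact_mod_cast hNN₁)
    have hscN : 1 ≤ Real.sqrt c * N := by
      rw [div_le_iff₀ hsc] at hN₁'
      linarith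
    set t : ℝ := c * (N : ℝ) ^ 2 with ht
    have hsqt : Real.sqrt t = Real.sqrt c * N := by
      rw [ht, Real.sqrt_mul hc.le, Real.sqrt_sq (by positivity)]
    have ht1 : 1 ≤ t := by
      have : t = (Real.sqrt c * N) ^ 2 := by
        rw [ht, mul_pow, Real.sq_sqrt hc.le]
      rw [this]
      nlinarith
    obtain ⟨hm, hi⟩ := hR ω₂ lam β γ hω hl hβ hγ T hT N
    have hfloor := integral_min_mul_ge_of_floor hm hi ht1
      (fun ω hω0 hω1 => hA N hN₀ ω hω0 hω1) (hB N hN₀' t ht1)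
    rw [hsqt] at hfloor
    have hs : -(Cmain * N) ≤ contactSurplus P T N t := by
      show -(Cmain * N) ≤ T ^ 2 * ∫ u in Ioi 0, min u t * contactImbalanceCorr P T N u
      have hT2 : 0 < T ^ 2 := by positivity
      have := mul_le_mul_of_nonneg_left hfloor hT2.le
      rw [hCmain]
      refine le_trans (le_of_eq ?_) this
      ring
    nlinarith

/-! ### The refined door -/

/-- **`BoundedResponse ⟸ K_T ∧ W ∧ (S) ∧ [R ∧ GK ∧ HB ∧ WF]`** — node g91's junction with its residual
`P` discharged through the equilibrium language change and the frequency-band split: the only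
`N`-uniform UNDECIDED inputs are `(S)`, the extensive block-energy variance `W` and the infrared floor
`WF` — all three EQUILIBRIUM statements; `R`, `GK`, `K_T` are fixed-`N` theorem-grade and `HB` is free in
substance (Bochner). [folklore] -/
theorem boundedResponse_of_contactSpectrum (hK : TransientContactBudgetFixedN)
    (hW : ExtensiveBlockEnergyVariance) (hR : ContactKernelRegular) (hG : ContactGreenKubo)
    (hH : HighBandSurplusFloor) (hF : ContactWarburgFloor) (hS : SubdiffusiveBondHeat) :
    BoundedResponse :=
  boundedResponse_of_transientContact' hK hW
    (transientContactSurplus_of_equilibriumSurplusFloor hR hG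
      (equilibriumSurplusFloor_of_spectralFloors hR hH hF)) hS

/-- **`BoundedResponse ⟸ K_T ∧ W ∧ (S) ∧ [R ∧ GK ∧ ESF]`** — the same with the residual kept at the
equilibrium-surplus level (no band split). [folklore] -/
theorem boundedResponse_of_equilibriumSurplusFloor (hK : TransientContactBudgetFixedN)
    (hW : ExtensiveBlockEnergyVariance) (hR : ContactKernelRegular) (hG : ContactGreenKubo)
    (hE : EquilibriumSurplusFloor) (hS : SubdiffusiveBondHeat) : BoundedResponse :=
  boundedResponse_of_transientContact' hK hW
    (transientContactSurplus_of_equilibriumSurplusFloor hR hG hE) hS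


/-! ### Stationary autocorrelations of exponentially dominated observables (fixed `N`)

The fixed-`N` technology of `KernelGibbsE` — CEHR exponential mixing with weight `e^{H/(4T)}`, Jensen for
the Markov transition kernel, Gibbs invariance, joint measurability in `(t, z)` — run for a general
continuous observable `θ` with `|θ| ≤ M e^{H/(4T)}` in place of `p₀² − T`. -/

section ObservableKernel

open Literature.MathematicalPhysics.KineticTheory Literature.Probability.Process OscillatorChain
open scoped NNReal

variable {ω₂ lam β γ T : ℝ} {N : ℕ}

/-- `u ↦ ∫ θ·(P_{u⁺}θ) dμ_T` is measurable for a continuous observable `θ` (joint measurability of the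
transition kernels, as in `pinnedChain_measurable_kinCorr`). [folklore] -/
theorem measurable_obsCorr (hω : 0 < ω₂) (hl : 0 < lam) (hβ : 0 < β) (hγ : 0 < γ) (hT : 0 < T)
    {θ : PhaseSpace N → ℝ} (hθc : Continuous θ) :
    Measurable fun u : ℝ => ∫ z, θ z *
        (∫ y, θ y ∂((pinnedChain ω₂ lam β γ).transitionKernel N T T u.toNNReal z))
      ∂((pinnedChain ω₂ lam β γ).gibbsMeasure N T) := by
  set P := pinnedChain ω₂ lam β γ with hP
  set μ := P.gibbsMeasure N T with hμ
  haveI : IsProbabilityMeasure μ :=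
    pinnedChain_isProbabilityMeasure_gibbsMeasure hω hl.le hβ.le γ N hT
  let κ₂ : Kernel (ℝ≥0 × PhaseSpace N) (PhaseSpace N) :=
    { toFun := fun p => P.transitionKernel N T T p.1 p.2
      measurable' := pinnedChain_measurable_transitionKernel hω hl.le hβ.le hγ.le N T T }
  have hG : StronglyMeasurable fun p : ℝ≥0 × PhaseSpace N => ∫ y, θ y ∂(κ₂ p) :=
    hθc.stronglyMeasurable.integral_kernel (κ := κ₂)
  have hF : StronglyMeasurable fun q : ℝ × PhaseSpace N =>
      θ q.2 * ∫ y, θ y ∂(P.transitionKernel N T T q.1.toNNReal q.2) := by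
    have h1 : StronglyMeasurable fun q : ℝ × PhaseSpace N => θ q.2 :=
      (hθc.comp continuous_snd).stronglyMeasurable
    have h2 : StronglyMeasurable fun q : ℝ × PhaseSpace N =>
        ∫ y, θ y ∂(κ₂ (q.1.toNNReal, q.2)) :=
      hG.comp_measurable ((measurable_real_toNNReal.comp measurable_fst).prodMk measurable_snd)
    exact h1.mul h2
  exact (hF.integral_prod_right' (ν := μ)).measurable

/-- **`|∫ θ·(P_uθ) dμ_T| ≤ ∫ θ² dμ_T`-type bound**: for a continuous `θ` with `|θ| ≤ M e^{H/(4T)}` and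
`∫ θ² dμ_T ≤ S`, `|∫ θ·(P_uθ) dμ_T| ≤ S` for every `u ≥ 0` (AM–GM, Jensen for the Markov kernel `P_u`,
invariance `∫ P_u(θ²) dμ_T = ∫ θ² dμ_T`; as in `pinnedChain_kinCorr_abs_le`). [folklore] -/
theorem obsCorr_abs_le (hω : 0 < ω₂) (hl : 0 < lam) (hβ : 0 < β) (hγ : 0 < γ) (hT : 0 < T)
    (hN : 0 < N) {θ : PhaseSpace N → ℝ} (hθc : Continuous θ) {M : ℝ}
    (hθM : ∀ y, |θ y| ≤ M * Real.exp (1 / (4 * T) * (pinnedChain ω₂ lam β γ).hamiltonian N y))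
    {S : ℝ} (hsq : ∫ z, θ z ^ 2 ∂((pinnedChain ω₂ lam β γ).gibbsMeasure N T) ≤ S) (u : ℝ≥0) :
    |∫ z, θ z * (∫ y, θ y ∂((pinnedChain ω₂ lam β γ).transitionKernel N T T u z))
      ∂((pinnedChain ω₂ lam β γ).gibbsMeasure N T)| ≤ S := by
  set P := pinnedChain ω₂ lam β γ with hP
  set μ := P.gibbsMeasure N T with hμ
  set κ := P.transitionKernel N T T u with hκ
  haveI : IsProbabilityMeasure μ :=
    pinnedChain_isProbabilityMeasure_gibbsMeasure hω hl.le hβ.le γ N hT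
  haveI : IsMarkovKernel κ :=
    pinnedChain_isMarkovKernel_transitionKernel hω hl.le hβ.le hγ.le N T T u
  set ϑ : ℝ := 1 / (4 * T) with hϑ
  have hϑ0 : 0 < ϑ := by positivity
  have hϑ1 : ϑ < 1 / T := by rw [hϑ, div_lt_div_iff₀ (by positivity) hT]; nlinarith
  have h2ϑ0 : 0 < 2 * ϑ := by positivity
  have h2ϑ : 2 * ϑ < 1 / T := by
    rw [hϑ, show 2 * (1 / (4 * T)) = 1 / (2 * T) by field_simp; ring,
      div_lt_div_iff₀ (by positivity) hT]
    nlinarith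
  have hθ2M : ∀ y, |θ y ^ 2| ≤ M ^ 2 * Real.exp (2 * ϑ * P.hamiltonian N y) := fun y => by
    rw [abs_pow, show M ^ 2 * Real.exp (2 * ϑ * P.hamiltonian N y) =
      (M * Real.exp (ϑ * P.hamiltonian N y)) ^ 2 by rw [mul_pow, ← Real.exp_nat_mul]; ring_nf]
    exact pow_le_pow_left₀ (abs_nonneg _) (hθM y) 2
  have hθκ : ∀ z, Integrable θ (κ z) := fun z => integrable_of_abs_le_exp
    (pinnedChain_integrable_exp_mul_hamiltonian_transitionKernel hω hl.le hT hβ.le hγ.le hN hϑ0 hϑ1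
      u z) hθc hθM
  have hθ2κ : ∀ z, Integrable (fun y => θ y ^ 2) (κ z) := fun z => integrable_of_abs_le_exp
    (pinnedChain_integrable_exp_mul_hamiltonian_transitionKernel hω hl.le hT hβ.le hγ.le hN h2ϑ0 h2ϑ
      u z) (hθc.pow 2) hθ2M
  have hθ2μ : Integrable (fun y => θ y ^ 2) μ := integrable_of_abs_le_exp
    (pinnedChain_integrable_exp_mul_hamiltonian_gibbsMeasure hω hl.le hβ.le γ N hT h2ϑ) (hθc.pow 2)
    hθ2M
  -- `g = P_u θ` and Jensen
  set g : PhaseSpace N → ℝ := fun z => ∫ y, θ y ∂(κ z) with hg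
  have hgm : StronglyMeasurable g := hθc.stronglyMeasurable.integral_kernel (κ := κ)
  have hjensen : ∀ z, g z ^ 2 ≤ ∫ y, θ y ^ 2 ∂(κ z) := by
    intro z
    have hvar : 0 ≤ ∫ y, (θ y - g z) ^ 2 ∂(κ z) := integral_nonneg fun y => sq_nonneg _
    have hexp : ∫ y, (θ y - g z) ^ 2 ∂(κ z) = (∫ y, θ y ^ 2 ∂(κ z)) - g z ^ 2 := by
      have e : (fun y => (θ y - g z) ^ 2) = fun y => θ y ^ 2 - (2 * g z) * θ y + g z ^ 2 := by
        funext y; ring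
      have i1 : Integrable (fun y => θ y ^ 2 - 2 * g z * θ y) (κ z) :=
        (hθ2κ z).sub ((hθκ z).const_mul _)
      rw [e, integral_add i1 (integrable_const _), integral_sub (hθ2κ z) ((hθκ z).const_mul _),
        integral_const_mul, integral_const]
      simp only [probReal_univ, smul_eq_mul, one_mul]
      rw [show (∫ y, θ y ∂(κ z)) = g z from rfl]
      ring
    linarith
  -- `P_u(θ²)` is `μ`-integrable with integral `∫ θ² dμ` (invariance)
  have hinv := pinnedChain_gibbsMeasure_bind_transitionKernel hω hl.le hβ.le hγ.le hN hT u
  have h' : (κ ∘ₖ Kernel.const Unit μ) () = μ := by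
    rw [← Measure.comp_eq_comp_const_apply]; exact hinv
  have hθ2' : Integrable (fun y => θ y ^ 2) ((κ ∘ₖ Kernel.const Unit μ) ()) := by
    rw [h']; exact hθ2μ
  have hP2int : Integrable (fun z => ∫ y, θ y ^ 2 ∂(κ z)) μ := by
    have := hθ2'.integral_comp
    rwa [Kernel.const_apply] at this
  have hP2val : ∫ z, (∫ y, θ y ^ 2 ∂(κ z)) ∂μ ≤ S := by
    rw [pinnedChain_integral_transitionKernel_gibbsMeasure hω hl.le hβ.le hγ.le hN hT u hθ2μ]
    exact hsq
  have hg2int : Integrable (fun z => g z ^ 2) μ :=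
    hP2int.mono' (hgm.measurable.pow_const 2).aestronglyMeasurable (Eventually.of_forall fun z => by
      rw [Real.norm_eq_abs, abs_of_nonneg (sq_nonneg _)]; exact hjensen z)
  have hg2le : ∫ z, g z ^ 2 ∂μ ≤ S :=
    (integral_mono_of_nonneg (Eventually.of_forall fun z => sq_nonneg _) hP2int
      (Eventually.of_forall hjensen)).trans hP2val
  -- AM–GM and integration
  have hbound : ∀ z, ‖θ z * g z‖ ≤ (θ z ^ 2 + g z ^ 2) / 2 := fun z => by
    rw [Real.norm_eq_abs, abs_mul]
    nlinarith [sq_nonneg (|θ z| - |g z|), sq_abs (θ z), sq_abs (g z), abs_nonneg (θ z),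
      abs_nonneg (g z)]
  have hbint : Integrable (fun z => (θ z ^ 2 + g z ^ 2) / 2) μ := (hθ2μ.add hg2int).div_const 2
  have := norm_integral_le_of_norm_le hbint (Eventually.of_forall hbound)
  rw [Real.norm_eq_abs, integral_div, integral_add hθ2μ hg2int] at this
  have hsq0 : ∫ z, θ z ^ 2 ∂μ ≤ S := hsq
  linarith

/-- **Exponential decay of `∫ θ·(P_uθ) dμ_T`** for a continuous mean-zero `θ` with `|θ| ≤ M e^{H/(4T)}`,
`M > 0`: `|∫ θ·(P_uθ) dμ_T| ≤ C e^{−cu}` (`u ≥ 0`, some `c > 0`) — CEHR exponential convergence with weight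
`e^{H/(4T)}` integrated against `|θ| e^{H/(4T)} ∈ L¹(μ_T)` (as in `pinnedChain_kinCorr_exp_decay`).
[cite: CuneoEckmannHairerReyBellet2018, Thm 2.13 (3)] -/
theorem obsCorr_exp_decay (hω : 0 < ω₂) (hl : 0 < lam) (hβ : 0 < β) (hγ : 0 < γ) (hT : 0 < T)
    (hN : 0 < N) {θ : PhaseSpace N → ℝ} (hθc : Continuous θ) {M : ℝ} (hM0 : 0 < M)
    (hθM : ∀ y, |θ y| ≤ M * Real.exp (1 / (4 * T) * (pinnedChain ω₂ lam β γ).hamiltonian N y))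
    (h0 : ∫ z, θ z ∂((pinnedChain ω₂ lam β γ).gibbsMeasure N T) = 0) :
    ∃ C c : ℝ, 0 < c ∧ ∀ u : ℝ, 0 ≤ u →
      |∫ z, θ z * (∫ y, θ y ∂((pinnedChain ω₂ lam β γ).transitionKernel N T T u.toNNReal z))
        ∂((pinnedChain ω₂ lam β γ).gibbsMeasure N T)| ≤ C * Real.exp (-c * u) := by
  set P := pinnedChain ω₂ lam β γ with hP
  set μ := P.gibbsMeasure N T with hμ
  set ϑ : ℝ := 1 / (4 * T) with hϑ
  have hϑ0 : 0 < ϑ := by positivity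
  have hϑ1 : ϑ < 1 / T := by
    rw [hϑ, div_lt_div_iff₀ (by positivity) hT]; nlinarith
  have h2ϑ : 2 * ϑ < 1 / T := by
    rw [hϑ]; rw [show 2 * (1 / (4 * T)) = 1 / (2 * T) by field_simp; ring]
    rw [div_lt_div_iff₀ (by positivity) hT]; nlinarith
  obtain ⟨C, c, hC, hc, hconv⟩ := pinnedChain_exp_convergence_gibbs hω hl.le hβ hγ hN hT hϑ0 hϑ1
  -- the weight `|θ| e^{ϑH} ≤ M e^{2ϑH}` is `μ_T`-integrable
  have hwint : Integrable (fun z => |θ z| * Real.exp (ϑ * P.hamiltonian N z)) μ := by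
    have h2 := pinnedChain_integrable_exp_mul_hamiltonian_gibbsMeasure hω hl.le hβ.le γ N hT h2ϑ
    refine (h2.const_mul M).mono' ((continuous_abs.comp hθc).mul (Real.continuous_exp.comp
      (continuous_const.mul
        (pinnedChain_continuous_hamiltonian ω₂ lam β γ N)))).aestronglyMeasurable
      (Eventually.of_forall fun z => ?_)
    rw [Real.norm_eq_abs, abs_mul, abs_abs, abs_of_pos (Real.exp_pos _)]
    calc |θ z| * Real.exp (ϑ * P.hamiltonian N z) ≤ (M * Real.exp (ϑ * P.hamiltonian N z)) *
        Real.exp (ϑ * P.hamiltonian N z) := mul_le_mul_of_nonneg_right (hθM z) (Real.exp_pos _).le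
      _ = M * Real.exp (2 * ϑ * P.hamiltonian N z) := by rw [mul_assoc, ← Real.exp_add]; ring_nf
  set W : ℝ := ∫ z, |θ z| * Real.exp (ϑ * P.hamiltonian N z) ∂μ with hW
  refine ⟨M * C * W, c, hc, fun u hu => ?_⟩
  -- pointwise decay of `P_u θ`
  have hpt : ∀ z, |∫ y, θ y ∂(P.transitionKernel N T T u.toNNReal z)| ≤
      M * C * Real.exp (ϑ * P.hamiltonian N z) * Real.exp (-c * u) := by
    intro z
    have hf : Continuous fun y => M⁻¹ * θ y := continuous_const.mul hθc
    have hfb : ∀ y, |M⁻¹ * θ y| ≤ Real.exp (ϑ * P.hamiltonian N y) := fun y => by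
      rw [abs_mul, abs_of_pos (inv_pos.2 hM0), inv_mul_le_iff₀ hM0]
      exact hθM y
    have h := hconv z u.toNNReal _ hf hfb
    rw [integral_const_mul, integral_const_mul, h0, mul_zero, sub_zero, abs_mul,
      abs_of_pos (inv_pos.2 hM0), inv_mul_le_iff₀ hM0, Real.coe_toNNReal _ hu] at h
    calc |∫ y, θ y ∂(P.transitionKernel N T T u.toNNReal z)|
        ≤ M * (C * Real.exp (ϑ * P.hamiltonian N z) * Real.exp (-c * u)) := h
      _ = M * C * Real.exp (ϑ * P.hamiltonian N z) * Real.exp (-c * u) := by ring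
  -- integrate
  have hbound : ∀ z, ‖θ z * ∫ y, θ y ∂(P.transitionKernel N T T u.toNNReal z)‖ ≤
      M * C * Real.exp (-c * u) * (|θ z| * Real.exp (ϑ * P.hamiltonian N z)) := fun z => by
    rw [Real.norm_eq_abs, abs_mul]
    calc |θ z| * |∫ y, θ y ∂(P.transitionKernel N T T u.toNNReal z)|
        ≤ |θ z| * (M * C * Real.exp (ϑ * P.hamiltonian N z) * Real.exp (-c * u)) :=
          mul_le_mul_of_nonneg_left (hpt z) (abs_nonneg _)
      _ = M * C * Real.exp (-c * u) * (|θ z| * Real.exp (ϑ * P.hamiltonian N z)) := by ring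
  have := norm_integral_le_of_norm_le (hwint.const_mul (M * C * Real.exp (-c * u)))
    (Eventually.of_forall hbound)
  rw [integral_const_mul, Real.norm_eq_abs] at this
  calc _ ≤ M * C * Real.exp (-c * u) * W := this
    _ = M * C * W * Real.exp (-c * u) := by ring

/-- **`∫ θ·(P_uθ) dμ_T ∈ L¹(0,∞)`** for a continuous mean-zero `θ` with `|θ| ≤ M e^{H/(4T)}`, `M > 0`
(measurability and exponential decay). [folklore] -/
theorem obsCorr_integrableOn (hω : 0 < ω₂) (hl : 0 < lam) (hβ : 0 < β) (hγ : 0 < γ) (hT : 0 < T)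
    (hN : 0 < N) {θ : PhaseSpace N → ℝ} (hθc : Continuous θ) {M : ℝ} (hM0 : 0 < M)
    (hθM : ∀ y, |θ y| ≤ M * Real.exp (1 / (4 * T) * (pinnedChain ω₂ lam β γ).hamiltonian N y))
    (h0 : ∫ z, θ z ∂((pinnedChain ω₂ lam β γ).gibbsMeasure N T) = 0) :
    IntegrableOn (fun u : ℝ => ∫ z, θ z *
        (∫ y, θ y ∂((pinnedChain ω₂ lam β γ).transitionKernel N T T u.toNNReal z))
      ∂((pinnedChain ω₂ lam β γ).gibbsMeasure N T)) (Ioi 0) := by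
  obtain ⟨C, c, hc, hb⟩ := obsCorr_exp_decay hω hl hβ hγ hT hN hθc hM0 hθM h0
  refine Integrable.mono' ((exp_neg_integrableOn_Ioi 0 hc).const_mul C)
    (measurable_obsCorr hω hl hβ hγ hT hθc).aestronglyMeasurable ?_
  refine (ae_restrict_iff' measurableSet_Ioi).2 (Eventually.of_forall fun u hu => ?_)
  rw [Real.norm_eq_abs]
  exact hb u (le_of_lt hu)

/-- `p_i⁴` is `μ_T`-integrable and `∫ (p_i² − T)² dμ_T ≤ 2T²` for EVERY site `i` (Gaussian momentum
marginal: `∫ p_i⁴ dμ_T = 3T²`, `∫ p_i² dμ_T = T`; the tree's `pinnedChain_integral_kinObs_sq_le` is the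
case `i = 0`). [folklore] -/
theorem integral_kinDev_sq_le (hω : 0 < ω₂) (hl : 0 < lam) (hβ : 0 < β) (hT : 0 < T) (i : Fin N) :
    Integrable (fun z : PhaseSpace N => (z.2 i ^ 2 - T) ^ 2)
        ((pinnedChain ω₂ lam β γ).gibbsMeasure N T) ∧
      ∫ z, (z.2 i ^ 2 - T) ^ 2 ∂((pinnedChain ω₂ lam β γ).gibbsMeasure N T) ≤ 2 * T ^ 2 := by
  haveI := pinnedChain_isProbabilityMeasure_gibbsMeasure hω hl.le hβ.le γ N hT
  have hi4 : Integrable (fun z : PhaseSpace N => z.2 i ^ 4)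
      ((pinnedChain ω₂ lam β γ).gibbsMeasure N T) :=
    (pinnedChain ω₂ lam β γ).integrable_gibbsMeasure
      (pinnedChain_integrable_momentum_pow_mul_gibbsDensity hω hl.le hβ.le γ N hT i le_rfl)
  have hi2 : Integrable (fun z : PhaseSpace N => z.2 i ^ 2)
      ((pinnedChain ω₂ lam β γ).gibbsMeasure N T) :=
    (pinnedChain ω₂ lam β γ).integrable_gibbsMeasure
      (pinnedChain_integrable_momentum_pow_mul_gibbsDensity hω hl.le hβ.le γ N hT i (by norm_num))
  have h4 : ∫ z, z.2 i ^ 4 ∂((pinnedChain ω₂ lam β γ).gibbsMeasure N T) = 3 * T ^ 2 := by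
    rw [(pinnedChain ω₂ lam β γ).integral_gibbsMeasure]
    have e4 := pinnedChain_integral_momentum_pow_add_two hω hl.le hβ.le γ N hT i (k := 2) le_rfl
    have e2 := pinnedChain_integral_momentum_pow_add_two hω hl.le hβ.le γ N hT i (k := 0)
      (Nat.zero_le _)
    have hZ : 0 < ∫ x, (pinnedChain ω₂ lam β γ).gibbsDensity N T x :=
      integral_exp_pos (pinnedChain_integrable_gibbsDensity hω hl.le hβ.le γ N hT)
    have h0 : ∫ x, x.2 i ^ 0 * (pinnedChain ω₂ lam β γ).gibbsDensity N T x =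
        ∫ x, (pinnedChain ω₂ lam β γ).gibbsDensity N T x := by simp
    simp only [Nat.reduceAdd, Nat.cast_ofNat, Nat.cast_zero, zero_add, mul_one] at e4 e2
    rw [h0] at e2
    rw [e4, e2]
    field_simp
    ring
  have h2 := pinnedChain_integral_sq_momentum_gibbsMeasure hω hl.le hβ.le γ N hT i
  have e : (fun z : PhaseSpace N => (z.2 i ^ 2 - T) ^ 2) =
      fun z => z.2 i ^ 4 - 2 * T * z.2 i ^ 2 + T ^ 2 := by
    funext z; ring
  have i1 : Integrable (fun z : PhaseSpace N => z.2 i ^ 4 - 2 * T * z.2 i ^ 2)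
      ((pinnedChain ω₂ lam β γ).gibbsMeasure N T) := hi4.sub (hi2.const_mul _)
  refine ⟨by rw [e]; exact i1.add (integrable_const _), ?_⟩
  rw [e, integral_add i1 (integrable_const _), integral_sub hi4 (hi2.const_mul _),
    integral_const_mul, integral_const, h2, h4]
  simp only [probReal_univ, smul_eq_mul, one_mul]
  nlinarith [sq_nonneg T]

end ObservableKernel

end Summit.AtomisticToContinuum.FouriersLaw.Theorems.BoundedResponse.TransientContact

end
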